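import Literature.Analysis.Matrix.FiniteRangeDecompositionPowSymbol
import Literature.Analysis.Fourier.ConvolutionOperatorMultiplier
import Mathlib.Analysis.SpecificLimits.Basic
import HarnessLib

/-!
# Finite-range decomposition of the PSEUDO-INVERSE (torus Green's function) of a translation-invariant operator

On a finite abelian group (discrete torus) a lattice "Laplacian" `A` — translation invariant, symmetric,
`0 ≤ A ≤ 4` — has a zero mode, so the object decomposed by the exact identity
`A · Σ_{N<J} C^{(m)}_N + R^{(m)}_J = 1` (`FiniteRangeDecompositionPow.frdPow_identity`) is not an inverse but the
pseudo-inverse `pinv A` (multiplier `σ_A⁻¹`, `ConvolutionOperatorMultiplier.lean`), and the identity is used on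
GRADIENTS, which kill the zero mode.  This file makes that standard remark ("on a torus one applies the identity on
the orthogonal complement of the kernel, the last term `A⁺R_J` being the last-scale covariance") a theorem:

* `pinv_eq_sum_frdPiecePow` — `pinv A = Σ_{N<J} C_N − |G|⁻¹𝟙·Σ_{N<J} C_N + pinv A · R_J` when the symbol of `A`
  vanishes exactly at the trivial character;
* **`rowDiffs_pinv_eq`** — for every NONEMPTY list of steps, `∇_l (pinv A) = Σ_{N<J} ∇_l C_N + ∇_l (pinv A · R_J)`;
* `abs_rowDiffs_pinv_mul_frdRemainderPow_le` — the last-scale term is negligible: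
  `|∇_l (pinv A · R^{(m)}_J)(x,y)| ≤ 2^k (π²/4^J)^m / a₀^{m+1}` if `a₀ ≤ σ_A` off the trivial character;
* **`abs_rowDiffs_pinv_le_sum_add`** — `|∇_l pinv A (x,y)| ≤ Σ_{N<J} |∇_l C^{(m)}_N (x,y)| + 2^k (π²/4^J)^m/a₀^{m+1}`
  for every `J`, and **`abs_rowDiffs_pinv_le_tsum`** — `|∇_l pinv A (x,y)| ≤ Σ_N b_N` for any summable family of
  piece bounds `|∇_l C^{(m)}_N (x,y)| ≤ b_N` (`m ≥ 1`): the gradients of the torus Green's function are controlled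
  scale by scale by the finite-range pieces, uniformly in the volume once the `b_N` are.

## References
* [BrydgesGuadagniMitter2004] D. Brydges, G. Guadagni, P. Mitter, J. Stat. Phys. 115 (2004) 415–449, Thm. 1.1.
* [Bauerschmidt2013] R. Bauerschmidt, Probab. Theory Relat. Fields 157 (2013) 817–845, Thm. 1.2, Rem. 1.3 (torus).
* [BauerschmidtBrydgesSlade2019] LNM 2242, Ch. 3–4 (the torus covariance and its decomposition).
-/

noncomputable section

open Finset Real
open Literature.Analysis.Fourier

namespace Literature.Analysis.Matrix

variable {G : Type*} [AddCommGroup G] [Fintype G] [DecidableEq G]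

/-! ## Iterated differences: additivity, matrices with constant rows -/

omit [Fintype G] [DecidableEq G] in
/-- Iterated differences are additive in the kernel. [folklore] -/
theorem rowDiffs_add (l : List G) (A B : _root_.Matrix G G ℝ) : rowDiffs l (A + B) = rowDiffs l A + rowDiffs l B := by
  induction l with
  | nil => rfl
  | cons g l ih => rw [rowDiffs_cons, ih, rowDiff_add]; rfl

omit [Fintype G] [DecidableEq G] in
/-- Iterated differences of a negated kernel. [folklore] -/
theorem rowDiffs_neg (l : List G) (A : _root_.Matrix G G ℝ) : rowDiffs l (-A) = -rowDiffs l A := by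
  rw [← neg_one_smul ℝ A, rowDiffs_smul, neg_one_smul]

omit [Fintype G] [DecidableEq G] in
/-- Iterated differences are subtractive in the kernel. [folklore] -/
theorem rowDiffs_sub (l : List G) (A B : _root_.Matrix G G ℝ) : rowDiffs l (A - B) = rowDiffs l A - rowDiffs l B := by
  rw [sub_eq_add_neg, rowDiffs_add, rowDiffs_neg, ← sub_eq_add_neg]

omit [Fintype G] [DecidableEq G] in
/-- A forward difference kills a matrix whose rows are all equal. [folklore] -/
theorem rowDiff_eq_zero_of_rows_eq {M : _root_.Matrix G G ℝ} (h : ∀ x x' y, M x y = M x' y) (g : G) :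
    rowDiff g M = 0 := by
  ext x y
  rw [rowDiff_apply, h (x + g) x y, sub_self, Matrix.zero_apply]

omit [Fintype G] [DecidableEq G] in
/-- A nonempty iterated difference kills a matrix whose rows are all equal. [folklore] -/
theorem rowDiffs_eq_zero_of_rows_eq {M : _root_.Matrix G G ℝ} (h : ∀ x x' y, M x y = M x' y) :
    ∀ {l : List G}, l ≠ [] → rowDiffs l M = 0
  | [], hl => absurd rfl hl
  | [g], _ => by rw [rowDiffs_cons, rowDiffs_nil, rowDiff_eq_zero_of_rows_eq h g]
  | g :: g' :: l, _ => by
    rw [rowDiffs_cons, rowDiffs_eq_zero_of_rows_eq h (l := g' :: l) (List.cons_ne_nil _ _)]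
    ext x y; simp

omit [AddCommGroup G] [DecidableEq G] in
/-- Left multiplication by the averaging matrix produces equal rows. [folklore] -/
theorem avg_mul_rows_eq (S : _root_.Matrix G G ℝ) (x x' y : G) :
    ((_root_.Matrix.of fun _ _ : G => (Fintype.card G : ℝ)⁻¹) * S) x y
      = ((_root_.Matrix.of fun _ _ : G => (Fintype.card G : ℝ)⁻¹) * S) x' y := by
  simp only [Matrix.mul_apply, Matrix.of_apply]

omit [DecidableEq G] in
/-- A product of `k` gradient factors `‖ψ(g) − 1‖` is at most `2^k`. [folklore] -/
theorem prod_norm_sub_one_le_two_pow (ψ : AddChar G ℂ) (l : List G) :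
    (l.map fun g => ‖ψ g - 1‖).prod ≤ 2 ^ l.length := by
  induction l with
  | nil => simp
  | cons g l ih =>
    rw [List.map_cons, List.prod_cons, List.length_cons, pow_succ, mul_comm ((2:ℝ) ^ _)]
    refine mul_le_mul (norm_addChar_sub_one_le ψ g) ih ?_ (by norm_num)
    exact List.prod_nonneg fun x hx => by
      obtain ⟨g', -, rfl⟩ := List.mem_map.mp hx
      exact norm_nonneg _

/-! ## The decomposition of the pseudo-inverse -/

section PInv

variable {A : _root_.Matrix G G ℝ}

/-- **The pseudo-inverse through the finite-range pieces**: if the symbol of `A` vanishes exactly at the trivial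
character, `pinv A = Σ_{N<J} C^{(m)}_N − |G|⁻¹𝟙 · Σ_{N<J} C^{(m)}_N + pinv A · R^{(m)}_J`.
[cite: Bauerschmidt2013, Rem. 1.3 (form)] -/
theorem pinv_eq_sum_frdPiecePow (hA : IsTranslationInvariant A) (h0 : ∀ ψ : AddChar G ℂ, symbol A ψ = 0 ↔ ψ = 1)
    (m J : ℕ) :
    pinv A = ∑ N ∈ Finset.range J, frdPiecePow A m N
      - (_root_.Matrix.of fun _ _ : G => (Fintype.card G : ℝ)⁻¹) * ∑ N ∈ Finset.range J, frdPiecePow A m N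
      + pinv A * frdRemainderPow A m J := by
  have h := congrArg (fun M => pinv A * M) (frdPow_identity A m J)
  simp only [mul_add, mul_one, ← mul_assoc] at h
  rw [pinv_mul_eq_mul_pinv hA, mul_pinv_eq_one_sub_avg hA h0, Matrix.sub_mul, Matrix.one_mul] at h
  exact h.symm

/-- **Gradients of the pseudo-inverse through the finite-range pieces**: for a nonempty list of steps,
`∇_l (pinv A) = Σ_{N<J} ∇_l C^{(m)}_N + ∇_l (pinv A · R^{(m)}_J)`. [cite: Bauerschmidt2013, Rem. 1.3 (form)] -/
theorem rowDiffs_pinv_eq (hA : IsTranslationInvariant A) (h0 : ∀ ψ : AddChar G ℂ, symbol A ψ = 0 ↔ ψ = 1)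
    (m J : ℕ) {l : List G} (hl : l ≠ []) :
    rowDiffs l (pinv A) = ∑ N ∈ Finset.range J, rowDiffs l (frdPiecePow A m N)
      + rowDiffs l (pinv A * frdRemainderPow A m J) := by
  conv_lhs => rw [pinv_eq_sum_frdPiecePow hA h0 m J]
  rw [rowDiffs_add, rowDiffs_sub, rowDiffs_sum, rowDiffs_eq_zero_of_rows_eq (avg_mul_rows_eq _) hl, sub_zero]

variable (hA : IsTranslationInvariant A) (hs : A.IsHermitian) (hP : A.PosSemidef)
  (h4 : ((4 : ℝ) • (1 : _root_.Matrix G G ℝ) - A).PosSemidef)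
include hA hs hP h4

/-- The symbol of the last-scale term `pinv A · R^{(m)}_J` is `σ_R/σ_A` (and `0` on the kernel of `A`). [folklore] -/
theorem norm_symbol_pinv_mul_frdRemainderPow (m J : ℕ) (ψ : AddChar G ℂ) :
    ‖symbol (pinv A * frdRemainderPow A m J) ψ‖ = ((symbol A ψ).re)⁻¹ * (symbol (frdRemainderPow A m J) ψ).re := by
  rw [symbol_mul ψ (pinv A) (isTranslationInvariant_frdRemainderPow hA m J), symbol_pinv, norm_mul, norm_inv]
  have ha : symbol A ψ = ((symbol A ψ).re : ℂ) := Complex.ext (by simp) (by simp [symbol_im ψ hA hs])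
  have hr : symbol (frdRemainderPow A m J) ψ = ((symbol (frdRemainderPow A m J) ψ).re : ℂ) :=
    Complex.ext (by simp) (by simp [symbol_frdRemainderPow_im ψ hA hs hP h4 m J])
  rw [ha, hr, Complex.norm_real, Complex.norm_real, Real.norm_eq_abs, Real.norm_eq_abs,
    abs_of_nonneg (symbol_re_nonneg ψ hA hP), abs_of_nonneg (symbol_frdRemainderPow_re_nonneg ψ hA hs hP h4 m J)]
  simp

/-- **The last-scale term is negligible**: if `a₀ ≤ σ_A(ψ)` for every non-trivial character and `σ_A(1) = 0`, then
`|∇_l (pinv A · R^{(m)}_J)(x,y)| ≤ 2^k · (π²/4^J)^m / a₀^{m+1}` (`k = |l|`). [folklore] -/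
theorem abs_rowDiffs_pinv_mul_frdRemainderPow_le (h0 : ∀ ψ : AddChar G ℂ, symbol A ψ = 0 ↔ ψ = 1)
    {a₀ : ℝ} (ha₀ : 0 < a₀) (hmin : ∀ ψ : AddChar G ℂ, ψ ≠ 1 → a₀ ≤ (symbol A ψ).re)
    (m J : ℕ) (l : List G) (x y : G) :
    |rowDiffs l (pinv A * frdRemainderPow A m J) x y| ≤ 2 ^ l.length * (π ^ 2 / 4 ^ J) ^ m / a₀ ^ (m + 1) := by
  have hT := abs_rowDiffs_apply_le ((isTranslationInvariant_pinv A).mul (isTranslationInvariant_frdRemainderPow hA m J))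
    l x y
  refine hT.trans ?_
  -- bound each term of the momentum average by the constant
  have hterm : ∀ ψ : AddChar G ℂ, (l.map fun g => ‖ψ g - 1‖).prod * ‖symbol (pinv A * frdRemainderPow A m J) ψ‖
      ≤ 2 ^ l.length * (π ^ 2 / 4 ^ J) ^ m / a₀ ^ (m + 1) := by
    intro ψ
    have hP0 : 0 ≤ (l.map fun g => ‖ψ g - 1‖).prod := List.prod_nonneg fun x hx => by
      obtain ⟨g', -, rfl⟩ := List.mem_map.mp hx
      exact norm_nonneg _
    have hK : 0 ≤ 2 ^ l.length * (π ^ 2 / 4 ^ J) ^ m / a₀ ^ (m + 1) := by positivity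
    rw [norm_symbol_pinv_mul_frdRemainderPow hA hs hP h4 m J ψ]
    by_cases hψ : ψ = 1
    · -- on the kernel the pseudo-inverse symbol vanishes
      have ha0 : (symbol A ψ).re = 0 := by rw [(h0 ψ).2 hψ]; simp
      rw [ha0, inv_zero, zero_mul, mul_zero]
      exact hK
    · have ha := hmin ψ hψ
      have hapos : 0 < (symbol A ψ).re := ha₀.trans_le ha
      have hRm := symbol_frdRemainderPow_re_mul_pow_le ψ hA hs hP h4 m J
      have hR0 := symbol_frdRemainderPow_re_nonneg ψ hA hs hP h4 m J
      -- `σ_R / a = σ_R a^m / a^{m+1} ≤ (π²/4^J)^m / a^{m+1} ≤ (π²/4^J)^m / a₀^{m+1}`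
      have h1 : ((symbol A ψ).re)⁻¹ * (symbol (frdRemainderPow A m J) ψ).re
          ≤ (π ^ 2 / 4 ^ J) ^ m / a₀ ^ (m + 1) := by
        have e1 : ((symbol A ψ).re)⁻¹ * (symbol (frdRemainderPow A m J) ψ).re
            = ((symbol A ψ).re)⁻¹ ^ (m + 1) * ((symbol (frdRemainderPow A m J) ψ).re * (symbol A ψ).re ^ m) := by
          rw [pow_succ, inv_pow]
          field_simp
        rw [e1, div_eq_mul_inv, ← inv_pow, mul_comm ((π ^ 2 / 4 ^ J) ^ m)]
        refine mul_le_mul ?_ hRm (mul_nonneg hR0 (pow_nonneg hapos.le _)) (by positivity)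
        exact pow_le_pow_left₀ (inv_nonneg.2 hapos.le) (inv_anti₀ ha₀ ha) _
      calc (l.map fun g => ‖ψ g - 1‖).prod * (((symbol A ψ).re)⁻¹ * (symbol (frdRemainderPow A m J) ψ).re)
          ≤ 2 ^ l.length * ((π ^ 2 / 4 ^ J) ^ m / a₀ ^ (m + 1)) :=
            mul_le_mul (prod_norm_sub_one_le_two_pow ψ l) h1
              (mul_nonneg (inv_nonneg.2 hapos.le) hR0) (by positivity)
        _ = 2 ^ l.length * (π ^ 2 / 4 ^ J) ^ m / a₀ ^ (m + 1) := by ring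
  have hc : (0 : ℝ) < Fintype.card G := by exact_mod_cast Fintype.card_pos
  calc (Fintype.card G : ℝ)⁻¹ * ∑ ψ : AddChar G ℂ,
        (l.map fun g => ‖ψ g - 1‖).prod * ‖symbol (pinv A * frdRemainderPow A m J) ψ‖
      ≤ (Fintype.card G : ℝ)⁻¹ * ∑ _ψ : AddChar G ℂ, 2 ^ l.length * (π ^ 2 / 4 ^ J) ^ m / a₀ ^ (m + 1) := by
        gcongr with ψ _
        exact hterm ψ
    _ = 2 ^ l.length * (π ^ 2 / 4 ^ J) ^ m / a₀ ^ (m + 1) := by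
        rw [Finset.sum_const, Finset.card_univ, AddChar.card_eq, nsmul_eq_mul, ← mul_assoc,
          inv_mul_cancel₀ hc.ne', one_mul]

/-- **Gradients of the torus Green's function, scale by scale**: for every `J` and every nonempty list of `k` steps,
`|∇_l pinv A (x,y)| ≤ Σ_{N<J} |∇_l C^{(m)}_N (x,y)| + 2^k (π²/4^J)^m / a₀^{m+1}`.
[cite: Bauerschmidt2013, Thm. 1.2 and Rem. 1.3 (form)] -/
theorem abs_rowDiffs_pinv_le_sum_add (h0 : ∀ ψ : AddChar G ℂ, symbol A ψ = 0 ↔ ψ = 1)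
    {a₀ : ℝ} (ha₀ : 0 < a₀) (hmin : ∀ ψ : AddChar G ℂ, ψ ≠ 1 → a₀ ≤ (symbol A ψ).re)
    (m J : ℕ) {l : List G} (hl : l ≠ []) (x y : G) :
    |rowDiffs l (pinv A) x y|
      ≤ ∑ N ∈ Finset.range J, |rowDiffs l (frdPiecePow A m N) x y| + 2 ^ l.length * (π ^ 2 / 4 ^ J) ^ m / a₀ ^ (m + 1) := by
  rw [rowDiffs_pinv_eq hA h0 m J hl, Matrix.add_apply, Matrix.sum_apply]
  refine (abs_add_le _ _).trans (add_le_add (Finset.abs_sum_le_sum_abs _ _) ?_)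
  exact abs_rowDiffs_pinv_mul_frdRemainderPow_le hA hs hP h4 h0 ha₀ hmin m J l x y

/-- **Gradients of the torus Green's function from summable piece bounds**: if `|∇_l C^{(m)}_N (x,y)| ≤ b_N` for all
`N` with `Σ b_N < ∞` and `m ≥ 1`, then `|∇_l pinv A (x,y)| ≤ Σ_N b_N` (nonempty `l`). [cite: Bauerschmidt2013, Rem. 1.3 (form)] -/
theorem abs_rowDiffs_pinv_le_tsum (h0 : ∀ ψ : AddChar G ℂ, symbol A ψ = 0 ↔ ψ = 1)
    {a₀ : ℝ} (ha₀ : 0 < a₀) (hmin : ∀ ψ : AddChar G ℂ, ψ ≠ 1 → a₀ ≤ (symbol A ψ).re)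
    {m : ℕ} (hm : 1 ≤ m) {l : List G} (hl : l ≠ []) (x y : G) {b : ℕ → ℝ}
    (hb : ∀ N, |rowDiffs l (frdPiecePow A m N) x y| ≤ b N) (hsum : Summable b) :
    |rowDiffs l (pinv A) x y| ≤ ∑' N, b N := by
  have hb0 : ∀ N, 0 ≤ b N := fun N => (abs_nonneg _).trans (hb N)
  refine le_of_forall_pos_le_add fun ε hε => ?_
  -- choose `J` with `2^k (π²/4^J)^m / a₀^{m+1} ≤ ε`
  have htail : Filter.Tendsto (fun J : ℕ => 2 ^ l.length * (π ^ 2 / 4 ^ J) ^ m / a₀ ^ (m + 1)) Filter.atTop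
      (nhds 0) := by
    have hq : Filter.Tendsto (fun J : ℕ => (π ^ 2 / 4 ^ J) ^ m) Filter.atTop (nhds 0) := by
      have h1 : Filter.Tendsto (fun J : ℕ => π ^ 2 / 4 ^ J) Filter.atTop (nhds 0) := by
        have : (fun J : ℕ => π ^ 2 / 4 ^ J) = fun J : ℕ => π ^ 2 * (1 / 4 : ℝ) ^ J := by
          funext J; rw [one_div_pow, div_eq_mul_one_div]
        rw [this]
        have h2 := tendsto_pow_atTop_nhds_zero_of_lt_one (by norm_num : (0 : ℝ) ≤ 1 / 4) (by norm_num : (1 / 4 : ℝ) < 1)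
        simpa using h2.const_mul (π ^ 2)
      have hm0 : m ≠ 0 := by omega
      simpa [zero_pow hm0] using h1.pow m
    have := (hq.const_mul (2 ^ l.length)).div_const (a₀ ^ (m + 1))
    simpa using this
  obtain ⟨J, hJ⟩ := (htail.eventually (gt_mem_nhds hε)).exists
  calc |rowDiffs l (pinv A) x y|
      ≤ ∑ N ∈ Finset.range J, |rowDiffs l (frdPiecePow A m N) x y| + 2 ^ l.length * (π ^ 2 / 4 ^ J) ^ m / a₀ ^ (m + 1) :=
        abs_rowDiffs_pinv_le_sum_add hA hs hP h4 h0 ha₀ hmin m J hl x y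
    _ ≤ ∑' N, b N + ε := by
        refine add_le_add ((Finset.sum_le_sum fun N _ => hb N).trans ?_) hJ.le
        exact hsum.sum_le_tsum _ fun N _ => hb0 N

end PInv

end Literature.Analysis.Matrix

end
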